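import Summits.QuantumFields.YangMills.Theorems.BalabanUVNodesK0AxTangentSocketNear
import Literature.MathematicalPhysics.QuantumFieldTheory.Balaban1983to89.Node00.MultiScaleFibreChart
import Literature.MathematicalPhysics.QuantumFieldTheory.Balaban1983to89.Node00.BgConstraintOfRecord

/-!
# NODE O · K0ᴬ — THE `Ψ`-LETTER SUPPLIED: onto-ness and strictness propagate from `0`, members sit in their fibres by the KNIT, and the CANONICAL FLAT LOGARITHMIC CHART
# `Ψ₀ := msChart F 2 K (k+1) (atScale (k+1)) Ū(1) 1` is two-point injective modulo the averages — ONE `Ψ`-letter left on the (R-a) road: `DΨ₀(0)` ONTO ([15] (45) at the flat configuration)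
# (FILE 8 of the «rooting is a gradient at first order» cut; consumes ✓`…K0AxTangentSocketNear` (§4f) and n07-w2's ✓`Node00.MultiScaleFibreChart` by name)

LANDING NOTE (porter ▶ PTC-1 g4, 2026-08-31; AUTHORSHIP = ◇ lens-1 g11 «cauchy-analytic», HOME sketch `nodeO-cover/LENS-1g11-TangentSocketPsi-v1.lean` sha16 d67bd72aa91592df · 367 l. · 15 thm, no
`def`, 0 sorry (CANDIDATE 6 = FILE 8: the `Ψ`-LETTER SUPPLIED — after it the (R-a) road's `Ψ`-side display is ONE letter, `Function.Surjective (fderiv ℝ Ψ₀ 0)` for the canonical flat log chart `Ψ₀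
:= msChart F 2 K (k+1) (atScale (k+1)) (avgFamily (avOfRecord F 2 K) 1) 1` = [15] (45) «`Q(1)` onto» at the flat configuration, the conclusion currency of dag-n10-w1's
✓`surjective_fderiv_msChart_of_flat`)): landed VERBATIM (only this paragraph added) under the basename ◇ lens-1 proposed (`…Theorems/BalabanUVNodesK0AxTangentSocketPsi.lean`) as INTENT-61, after
✓p822120 `…K0AxTangentSocketNear`; imports also ✓`Node00.MultiScaleFibreChart` + ✓`Node00.BgConstraintOfRecord` (`smallBelow_avOfRecord_one` CITED, not re-declared); `--supports
stmt-QuantumFields-27238 --as helper` (NO `--workitem`; kind proof — no `def`); ◆ CRIT-1's cut: ◆ CRIT-1 g38 «CUT + J-STAMP: GO VERBATIM; J4 15∕15 fresh; J1′ on the one new displayed letter `hon`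
= LOCATED-A, price LOW (explicit right inverse, CANDIDATE 7 discharges it for `k+2 ≤ m+K`); J5′ EXEMPT; (Q-ord) legal; RATE-LEVER neutral; SAME-WALL: SURVIVES (priced) — a NET DISPLAY REDUCTION,
not a rename; axioms standard on ◆'s run» (nodeO STATUS 2026-08-31T12:04:14Z).  HONEST (porter): topology ∕ linear algebra ∕ bookkeeping over the tree's `msChart` API; CONDITIONAL over DISPLAYED
letters inhabited NOWHERE ((45)-onto at flat, (s-exp)'s two scheme letters, `X`-regularity, KNIT tokens, (J-crit′), (J-cons′)); (C-tab-opt) STRUCK; nothing of Bałaban asserted, ported, discharged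
or refuted; K0ᴬ stmt-QuantumFields-27238 ∕ K0⁷ 20541 OPEN — NOTHING of them proved; NODE O 0∕1; COUNT 8∕28 · K 1∕4 UNMOVED; finite 𝕋⁴ at fixed ε — NOT continuum ∕ OS ∕ Clay; the Yang–Mills mass
gap is NOT proved by any of this.

◇ `ymgap-nodeO-lens-1` g11 (planner; typed for the porter ▶ PTC-1; proposed basename `…/Theorems/BalabanUVNodesK0AxTangentSocketPsi.lean`,
`--supports stmt-QuantumFields-27238 --as helper`).  Items: K0ᴬ stmt-QuantumFields-27238 OPEN; K0⁷ stmt-QuantumFields-20541 OPEN.  [15] = [Balaban1985Variational],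
[RS] = [Balaban1985RegularSpaces], [I] = [Balaban1987RG1], [III] = [Balaban1988Convergent], [Av] = [Balaban1985Averaging].

WHY.  After FILE 7 the `Ψ`-side of the (R-a) road displays a FAMILY clause «∀ᶠ B: `DΨ(X B)` strict and ONTO, local level sets through `X B` inside the one-scale fibre of `W B`» plus «`DΨ`
differentiable at `0`» and the datum clause.  All of it follows from THREE POINTWISE properties of ONE chart AT `0` — `C²` at `0`; `DΨ(0)` onto; two-point injectivity modulo the
level-`(k+1)` averages near `(0,0)` — together with `X 0 = 0`, `X` continuous, and «members in their fibres», which the KNIT `range` token gives at the fixed point.  And for the CANONICAL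
chart of n07-w2 (`Node00.msChart`, the logarithmic chart of the averages) at the FLAT reference, two of the three are theorems here (`C²`: ✓`contDiffAt_msChart`; two-point injectivity: the
logarithmic end ✓`coe_suProj_mlog_of_mem_SU` ∕ ✓`exp_mlog` run on two moving points), so that exactly ONE `Ψ`-letter remains: `Function.Surjective (fderiv ℝ Ψ₀ 0)` — [15] (45) «`Q(1)` onto»
at the flat configuration, the currency of dag-n10-w1's ✓`surjective_fderiv_msChart_of_flat`.

WHAT IS PROVED (kernel, sorry-free, standard axioms; namespace `K0AxCtabUniq`, sections `PsiSuppliers` ∕ `PsiSuppliersRecord` ∕ `LogChartTwoPoint` ∕ `LogChartRecord`).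
§4g ★ `eventually_range_fderiv_eq_top_of_surjective` (generic finite-dimensional target: ONTO-NESS OF `DΨ` IS OPEN — right inverse + units of `V →L[ℝ] V` are open);
★ `eventually_hasStrictFDerivAt_of_contDiffAt`, `differentiableAt_fderiv_of_contDiffAt_of_two` (`C²` at a point ⟹ strict nearby, `DΨ` differentiable); `eventually_nhds_eventually_pair_of_prod`
(pull-back of a two-point germ along a continuous family); ★★ `eventually_avgFamily_expChart_eq_unitField` (KNIT `range` at `S.sol` + (s-exp) ⟹ `M̄^{k+1}(e^{X B}) = unitField B` near `0`);
★★★ `psiLetter_near_of_pointwise` (the three pointwise properties + members-in-fibres ⟹ FILE 7's `hsub` clause); ★★★ `rootedReceipts_of_tokens_atScale_pointwise` (KNIT + (s-exp) + `X 0 = 0`, `X` C²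
+ `Ψ` C² at `0` + `DΨ(0)` onto + two-point injectivity + datum clause + (J-crit′) + (J-cons′) ⟹ (∀ a l, four rooted receipts) ∧ TokP9reg♭ᵣ).
§4h `eq_of_suProj_mlog_eq` (two-point level-set step in `SU(N)`), `avgFamily_eq_of_relAvg_eq`, ★ `eventually_avgFamily_eq_of_msChart_eq_pair` (generic `N`, any level-bounded `𝐁`, any guarded
base in the fibre), ★ `eventually_avgFamily_atScale_eq_of_msChart_eq_pair`, `agreeOn_avgFamily_self` (flat guard: def-R's ✓`Node00.smallBelow_avOfRecord_one`), ★ `contDiffAt_msChart_flat`,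
★ `eventually_avgFamily_eq_of_msChart_flat_eq_pair` (the `hinj` clause INHABITED for `Ψ₀`); ★★★ `rootedReceipts_of_tokens_atScale_flatLogChart` — binders: KNIT tokens + `RegimeTok` + domain
letter; (s-exp); `X 0 = 0`, `ContDiffAt ℝ 2 X 0`; `Function.Surjective (fderiv ℝ Ψ₀ 0)`; (J-crit′) `FlatCritDictionary F k K Ψ₀`; (J-cons′) `FlatConsDictionary F θ k K Ψ₀ (Ψ₀ ∘ X)` ⟹ (∀ a l,
four rooted receipts) ∧ TokP9reg♭ᵣ (datum `:= Ψ₀ ∘ X`, datum clause `rfl`).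

HONEST.  Finite-dimensional calculus and topology (openness of units, `C² ⇒` strict, product filters) + n07-w2's logarithmic end on two points; CONDITIONAL theorems over DISPLAYED letters
(KNIT∕def-Y tokens, (s-exp), `X`-regularity, [15] (45) at the flat configuration, (J-crit′), (J-cons′)) inhabited NOWHERE; nothing of Bałaban ([15] Thm 1, (45), Prop. 3, Prop. 6–9,
(82)–(83), (176)–(178); [RS] (1.113)–(1.114); [III] (2.10)–(2.12); [I] (0.4), (0.21)) is asserted, ported or discharged; (C-tab-opt) stays STRUCK; K0ᴬ 27238 ∕ K0⁷ 20541 OPEN — NOTHING of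
them proved; NODE O 0∕1; COUNT 8∕28 · K 1∕4 UNMOVED; finite 𝕋⁴_{L^K} at fixed ε — NOT continuum ∕ OS ∕ Clay; **the Yang–Mills mass gap is NOT proved by any of this.**  No `sorry`, no
`instance ∕ notation ∕ set_option`; standard axioms.
-/

noncomputable section

open Filter Topology
open scoped BigOperators Matrix.Norms.L2Operator

namespace Summit.QuantumFields.YangMills.Theorems.K0AxCtabUniq

open Literature.MathematicalPhysics.QuantumFieldTheory.Balaban1983to89
open LatticeFieldCalculus B6SectADomainsV1 B6SectAOperatorsV1 B6SectAVectorModelV1 B6SectACriticalPointV1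
open Literature.MathematicalPhysics.QuantumFieldTheory.Balaban1983to89.T4Continuum (T4Family)
open Literature.MathematicalPhysics.QuantumFieldTheory.Balaban1983to89.Node00
open T4RootedResidualGauge (rootGauge)
open GaugeField (gaugeAct)
open B12GaugeOrbits021 (IsResidual OrbitRel)
open B11Prop6Scheme (mapT)
open Summit.QuantumFields.YangMills.Theorems.K0RecordFormatNames
open Summit.QuantumFields.YangMills.Theorems.K0AxRootGrad

variable (F : T4Family) (θ : Stage13Params F 2)


/-! ### §4f  THE LOCAL (v1.1) EDITION OF THE SUBMERSION LETTER: level sets of `Ψ` lie in the fibres only NEAR each member — the form n07-e's canonical logarithmic chart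
`msChart` satisfies (`Node00.IsFibreChartNear`, ✓`isFibreChartNear_msChart`) — and the whole (R-a) chain re-run on it -/

/-! ### §4g  SUPPLIERS OF THE LOCAL `Ψ`-LETTER: onto-ness and strictness PROPAGATE from `0`; local level sets from TWO-POINT injectivity modulo the level-`(k+1)` averages; members sit in
their fibres by the KNIT `range` token — so the `Ψ`-side display shrinks to three properties of ONE fixed chart AT `0` (no family quantifier) -/

section PsiSuppliers

open T4AdjointCovarianceUnitary (lieSU expSU coe_expSU)
open B15DeterminingSets (DetSet MSField AgreeOn avgFamily atScale agreeOn_atScale_iff)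

/-- ★ **ONTO-NESS OF THE DERIVATIVE IS AN OPEN CONDITION** (finite-dimensional target): if `Y ↦ DΨ(Y)` is differentiable (so continuous) at `Y₀` and `DΨ(Y₀)` is onto, then `DΨ(Y)` is onto for all `Y` near `Y₀` —
a right inverse `R` of `DΨ(Y₀)` makes `DΨ(Y) ∘ R` a small perturbation of the identity of `V`, hence a unit of `V →L[ℝ] V` (units are open).  Turns [15] (45) «`Q` onto AT the flat ∕ record
configuration» into the family clause «onto at every member near `0`». [cite: Balaban1985Variational, (45) p.285, (81)–(83) p.290 (bookkeeping)] -/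
theorem eventually_range_fderiv_eq_top_of_surjective {E V : Type*} [NormedAddCommGroup E] [NormedSpace ℝ E]
    [NormedAddCommGroup V] [NormedSpace ℝ V] [FiniteDimensional ℝ V] {Ψ : E → V} {Y₀ : E}
    (hd : DifferentiableAt ℝ (fun Y => fderiv ℝ Ψ Y) Y₀) (hon : Function.Surjective (fderiv ℝ Ψ Y₀)) :
    ∀ᶠ Y in 𝓝 Y₀, ((fderiv ℝ Ψ Y : E →ₗ[ℝ] V).range = ⊤) := by
  haveI : CompleteSpace V := FiniteDimensional.complete ℝ V
  have hc : ContinuousAt (fun Y => fderiv ℝ Ψ Y) Y₀ := hd.continuousAt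
  obtain ⟨R₀, hR₀⟩ := LinearMap.exists_rightInverse_of_surjective (fderiv ℝ Ψ Y₀ : E →ₗ[ℝ] V) (LinearMap.range_eq_top.2 hon)
  set R : V →L[ℝ] E := LinearMap.toContinuousLinearMap R₀ with hRdef
  have hRid : ∀ v, fderiv ℝ Ψ Y₀ (R v) = v := fun v => by
    have := LinearMap.congr_fun hR₀ v
    simpa [hRdef] using this
  have hM : ContinuousAt (fun Y => (fderiv ℝ Ψ Y).comp R) Y₀ :=
    ((ContinuousLinearMap.precomp V R).continuous.continuousAt).comp hc
  have h1 : (fderiv ℝ Ψ Y₀).comp R = (1 : V →L[ℝ] V) := by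
    ext v; simp [hRid]
  have hU : ∀ᶠ Y in 𝓝 Y₀, IsUnit ((fderiv ℝ Ψ Y).comp R) := by
    have hopen : IsOpen {M : V →L[ℝ] V | IsUnit M} := Units.isOpen
    have hmem : (fun Y => (fderiv ℝ Ψ Y).comp R) Y₀ ∈ {M : V →L[ℝ] V | IsUnit M} := by
      show IsUnit ((fderiv ℝ Ψ Y₀).comp R)
      rw [h1]; exact isUnit_one
    exact hM.preimage_mem_nhds (hopen.mem_nhds hmem)
  filter_upwards [hU] with Y hY
  refine LinearMap.range_eq_top.2 fun v => ?_
  obtain ⟨M', hM'⟩ := hY.exists_right_inv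
  refine ⟨R (M' v), ?_⟩
  have := congrArg (fun T : V →L[ℝ] V => T v) hM'
  simpa using this

/-- ★ **STRICT DIFFERENTIABILITY PROPAGATES FROM `C²` AT A POINT**: `Ψ` of class `C²` at `Y₀` is strictly differentiable, with derivative `DΨ(Y)`, at every `Y` near `Y₀`.
[cite: Balaban1985Variational, (81)–(83) p.290 (bookkeeping)] -/
theorem eventually_hasStrictFDerivAt_of_contDiffAt {E V : Type*} [NormedAddCommGroup E] [NormedSpace ℝ E]
    [NormedAddCommGroup V] [NormedSpace ℝ V] {Ψ : E → V} {Y₀ : E} (h : ContDiffAt ℝ 2 Ψ Y₀) :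
    ∀ᶠ Y in 𝓝 Y₀, HasStrictFDerivAt Ψ (fderiv ℝ Ψ Y) Y :=
  (h.eventually (by simp)).mono fun Y hY => hY.hasStrictFDerivAt (by norm_num)

/-- `C²` at a point gives the binder `hΨd` («`DΨ` differentiable at `0`»). [cite: Balaban1985Variational, (81)–(83) p.290 (bookkeeping)] -/
theorem differentiableAt_fderiv_of_contDiffAt_of_two {E V : Type*} [NormedAddCommGroup E] [NormedSpace ℝ E]
    [NormedAddCommGroup V] [NormedSpace ℝ V] {Ψ : E → V} {Y₀ : E} (h : ContDiffAt ℝ 2 Ψ Y₀) :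
    DifferentiableAt ℝ (fun Y => fderiv ℝ Ψ Y) Y₀ :=
  (h.fderiv_right (m := 1) (by norm_num)).differentiableAt (by norm_num)

/-- **PULL-BACK OF A TWO-POINT GERM ALONG A CONTINUOUS FAMILY**: a property of pairs holding near `(X g₀, X g₀)` holds, for `g` near `g₀`, for all `Y` near `X g` paired with `X g`.
[cite: Balaban1985Variational, (81)–(83) p.290 (bookkeeping)] -/
theorem eventually_nhds_eventually_pair_of_prod {E G : Type*} [TopologicalSpace E] [TopologicalSpace G] {X : G → E} {g₀ : G}
    {P : E → E → Prop} (h : ∀ᶠ q in 𝓝 (X g₀, X g₀), P q.1 q.2) (hX : ContinuousAt X g₀) :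
    ∀ᶠ g in 𝓝 g₀, ∀ᶠ Y in 𝓝 (X g), P Y (X g) := by
  have h' : ∀ᶠ q in 𝓝 (X g₀, g₀), P q.1 (X q.2) := by
    have ht : Tendsto (fun q : E × G => (q.1, X q.2)) (𝓝 (X g₀, g₀)) (𝓝 (X g₀, X g₀)) := by
      have h1 : ContinuousAt (fun q : E × G => (q.1, X q.2)) (X g₀, g₀) :=
        continuousAt_fst.prodMk (hX.comp continuousAt_snd)
      simpa using h1.tendsto
    exact ht.eventually h
  exact eventually_nhds_eventually_nhds_of_prod (P := fun Y g => P Y (X g)) h' hX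

/-- ★★ **MEMBERS SIT IN THEIR ONE-SCALE FIBRES, FROM THE KNIT**: near `B = 0` the level-`(k+1)` average of the exponential presentation `expChart 1 (X B)` of def-Y's chart configuration is
the unit-lattice field — the `range` token at the fixed point (`S.chart V (S.sol V) = S.chartCfg V`), transported along (s-exp). [cite: Balaban1985Variational, Thm 1 p.279, (29)–(35) p.283] -/
theorem eventually_avgFamily_expChart_eq_unitField {𝒴 𝒵 : Type} [NormedAddCommGroup 𝒴] [NormedSpace ℂ 𝒴] [NormedAddCommGroup 𝒵] [NormedSpace ℂ 𝒵]
    (k K : ℕ) (S : BgScheme F 2 𝒴 𝒵 K (k + 1)) (Kc : GaugeField (F.P K) (k + 1) (SU 2) → Set 𝒴)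
    (range : ∀ V ∈ S.dom, ∀ A ∈ Kc V, S.chart V A ∈ bgReg F 2 K (k + 1) θ.εbg ∧ Averaging.iter (avOfRecord F 2 K) (k + 1) (S.chart V A) = V)
    (star_mem : ∀ V ∈ S.dom, S.sol V ∈ Kc V)
    (hdom : letI := θ.instVβ₁; letI := θ.instVβ₂;
      ∀ᶠ B in 𝓝 (0 : Fin (F.P K).d → Site (F.P K) (k + 1) → θ.Vβ), unitField F θ k K B ∈ S.dom)
    (X : (Fin (F.P K).d → Site (F.P K) (k + 1) → θ.Vβ) → PBond (F.P K) 0 → lieSU (Fin 2))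
    (hSX : letI := θ.instVβ₁; letI := θ.instVβ₂;
      (fun B => S.chartCfg (unitField F θ k K B)) =ᶠ[𝓝 (0 : Fin (F.P K).d → Site (F.P K) (k + 1) → θ.Vβ)]
        fun B => expChart (1 : GaugeField (F.P K) 0 (SU 2)) (X B)) :
    letI := θ.instVβ₁; letI := θ.instVβ₂;
    ∀ᶠ B in 𝓝 (0 : Fin (F.P K).d → Site (F.P K) (k + 1) → θ.Vβ),
      avgFamily (avOfRecord F 2 K) (expChart (1 : GaugeField (F.P K) 0 (SU 2)) (X B)) (k + 1) = unitField F θ k K B := by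
  letI := θ.instVβ₁; letI := θ.instVβ₂
  filter_upwards [hdom, hSX] with B hB hSB
  have h := (range _ hB _ (star_mem _ hB)).2
  rw [S.chart_sol] at h
  have hSB' : S.chartCfg (unitField F θ k K B) = expChart (1 : GaugeField (F.P K) 0 (SU 2)) (X B) := hSB
  simpa [avgFamily, hSB'] using h

/-- ★★★ **THE LOCAL `Ψ`-LETTER FROM THREE PROPERTIES OF ONE CHART AT `0`**: for a continuous presentation `X` with `X 0 = 0`, a chart `Ψ` that is `C²` at `0` with `DΨ(0)` ONTO and
TWO-POINT INJECTIVE MODULO THE LEVEL-`(k+1)` AVERAGES near `(0, 0)` («`Ψ Y = Ψ Y′ ⇒ M̄^{k+1}(e^{Y}) = M̄^{k+1}(e^{Y′})` for `Y, Y′` near `0`» — the logarithmic end of n07-e's canonical chart),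
and members in their fibres (`M̄^{k+1}(e^{X B}) = W B (k+1)` near `0`): the `hsub` clause of ★★★`rootedReceipts_of_tokens_atScale_near` holds — strict derivative onto at every member and
local level sets inside the one-scale fibres. [cite: Balaban1985Variational, (45) p.285, (81)–(83) p.290; Balaban1988Convergent, (2.10)–(2.12) p.256] -/
theorem psiLetter_near_of_pointwise {ι : Type*} [TopologicalSpace ι] [Zero ι] (k K : ℕ)
    {V : Type*} [NormedAddCommGroup V] [NormedSpace ℝ V] [FiniteDimensional ℝ V]
    (W : ι → MSField (F.P K) (SU 2)) (X : ι → PBond (F.P K) 0 → lieSU (Fin 2)) (Ψ : (PBond (F.P K) 0 → lieSU (Fin 2)) → V)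
    (hX₀ : X 0 = 0) (hXc : ContinuousAt X 0) (hΨ : ContDiffAt ℝ 2 Ψ 0) (hon : Function.Surjective (fderiv ℝ Ψ 0))
    (hinj : ∀ᶠ q in 𝓝 ((0 : PBond (F.P K) 0 → lieSU (Fin 2)), (0 : PBond (F.P K) 0 → lieSU (Fin 2))), Ψ q.1 = Ψ q.2 →
      avgFamily (avOfRecord F 2 K) (expChart (1 : GaugeField (F.P K) 0 (SU 2)) q.1) (k + 1) =
        avgFamily (avOfRecord F 2 K) (expChart (1 : GaugeField (F.P K) 0 (SU 2)) q.2) (k + 1))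
    (hmem : ∀ᶠ B in 𝓝 (0 : ι), avgFamily (avOfRecord F 2 K) (expChart (1 : GaugeField (F.P K) 0 (SU 2)) (X B)) (k + 1) = W B (k + 1)) :
    ∀ᶠ B in 𝓝 (0 : ι),
      HasStrictFDerivAt Ψ (fderiv ℝ Ψ (X B)) (X B) ∧
        ((fderiv ℝ Ψ (X B) : (PBond (F.P K) 0 → lieSU (Fin 2)) →ₗ[ℝ] V).range = ⊤) ∧
        ∀ᶠ Y in 𝓝 (X B), Ψ Y = Ψ (X B) →
          AgreeOn (atScale (k + 1)) (avgFamily (avOfRecord F 2 K) (expChart (1 : GaugeField (F.P K) 0 (SU 2)) Y)) (W B) := by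
  have hT : Tendsto X (𝓝 0) (𝓝 0) := by simpa [hX₀] using hXc.tendsto
  have hstrict := hT.eventually (eventually_hasStrictFDerivAt_of_contDiffAt hΨ)
  have honto := hT.eventually (eventually_range_fderiv_eq_top_of_surjective (differentiableAt_fderiv_of_contDiffAt_of_two hΨ) hon)
  have hinj' : ∀ᶠ q in 𝓝 (X 0, X 0), Ψ q.1 = Ψ q.2 →
      avgFamily (avOfRecord F 2 K) (expChart (1 : GaugeField (F.P K) 0 (SU 2)) q.1) (k + 1) =
        avgFamily (avOfRecord F 2 K) (expChart (1 : GaugeField (F.P K) 0 (SU 2)) q.2) (k + 1) := by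
    simpa [hX₀] using hinj
  have hlev := eventually_nhds_eventually_pair_of_prod (P := fun Y Y' => Ψ Y = Ψ Y' →
      avgFamily (avOfRecord F 2 K) (expChart (1 : GaugeField (F.P K) 0 (SU 2)) Y) (k + 1) =
        avgFamily (avOfRecord F 2 K) (expChart (1 : GaugeField (F.P K) 0 (SU 2)) Y') (k + 1)) hinj' hXc
  filter_upwards [hstrict, honto, hlev, hmem] with B hs ho hl hm
  refine ⟨hs, ho, ?_⟩
  filter_upwards [hl] with Y hY hΨY
  rw [agreeOn_atScale_iff]
  rw [hY hΨY, hm]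

end PsiSuppliers

section PsiSuppliersRecord

open T4AdjointCovarianceUnitary (lieSU expSU coe_expSU)
open B15DeterminingSets (DetSet MSField AgreeOn avgFamily atScale agreeOn_atScale_iff)

/-- ★★★ **ROOTED RECEIPTS + TokP9reg♭ᵣ FROM THE KNIT AND THREE POINTWISE PROPERTIES OF ONE CHART** (the (R-a) road with the `Ψ`-letter SUPPLIED): binders = KNIT tokens + `RegimeTok` +
domain letter; (s-exp) (def-Y: `S.bg = 1` + a Lie presentation `X` of the exponent, §4d); `X 0 = 0`, `X` of class `C²` at `0`; ONE chart `Ψ` of the level-`(k+1)` averages, `C²` at `0`,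
`DΨ(0)` ONTO ([15] (45) AT ONE configuration — dag-n10-w1's ✓`surjective_fderiv_msChart_of_flat` currency), two-point injective modulo the level-`(k+1)` averages near `(0,0)` (n07-e's
logarithmic end); the datum clause; (J-crit′); (J-cons′).  Minimality, members-in-fibres, strictness and onto-ness ALONG THE FAMILY are all DERIVED here.  CONDITIONAL; nothing of
[15] asserted. [cite: Balaban1985Variational, Thm 1 p.279, (45) p.285, Prop. 6 p.295, (82)–(83) p.290, Prop. 8 p.304, Prop. 9 p.309, (177)–(182) p.306–307; Balaban1985RegularSpaces,
(1.113)–(1.114) pp.95–97; Balaban1988Convergent, (2.10)–(2.12) p.256] -/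
theorem rootedReceipts_of_tokens_atScale_pointwise {𝒴 𝒵 : Type} [NormedAddCommGroup 𝒴] [NormedSpace ℂ 𝒴] [CompleteSpace 𝒴] [NormedAddCommGroup 𝒵] [NormedSpace ℂ 𝒵]
    (k K : ℕ) (hk : k + 1 ≤ (F.P K).m + (F.P K).K) (S : BgScheme F 2 𝒴 𝒵 K (k + 1))
    (hR : S.RegimeTok) (Kc : GaugeField (F.P K) (k + 1) (SU 2) → Set 𝒴)
    (range : ∀ V ∈ S.dom, ∀ A ∈ Kc V, S.chart V A ∈ bgReg F 2 K (k + 1) θ.εbg ∧ Averaging.iter (avOfRecord F 2 K) (k + 1) (S.chart V A) = V)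
    (covers : ∀ V ∈ S.dom, ∀ U : GaugeField (F.P K) 0 (SU 2), U ∈ bgReg F 2 K (k + 1) θ.εbg →
      Averaging.iter (avOfRecord F 2 K) (k + 1) U = V → ∃ A ∈ Kc V, OrbitRel (k + 1) (S.chart V A) U)
    (sol_of_isMinOn : ∀ V ∈ S.dom, ∀ A ∈ Kc V, IsMinOn (wilsonAction4 ∘ S.chart V) (Kc V) A →
      ‖A‖ ≤ S.ε₄ ∧ mapT (S.𝒢 V) 0 (S.W V) (S.J V) (S.𝔄 V) A = A)
    (star_mem : ∀ V ∈ S.dom, S.sol V ∈ Kc V) (star_isMinOn : ∀ V ∈ S.dom, IsMinOn (wilsonAction4 ∘ S.chart V) (Kc V) (S.sol V))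
    (hdom : letI := θ.instVβ₁; letI := θ.instVβ₂;
      ∀ᶠ B in 𝓝 (0 : Fin (F.P K).d → Site (F.P K) (k + 1) → θ.Vβ), unitField F θ k K B ∈ S.dom)
    {V : Type*} [NormedAddCommGroup V] [NormedSpace ℝ V] [FiniteDimensional ℝ V]
    (W : (Fin (F.P K).d → Site (F.P K) (k + 1) → θ.Vβ) → MSField (F.P K) (SU 2)) (hW : ∀ B, W B (k + 1) = unitField F θ k K B)
    (X : (Fin (F.P K).d → Site (F.P K) (k + 1) → θ.Vβ) → PBond (F.P K) 0 → lieSU (Fin 2))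
    (Ψ : (PBond (F.P K) 0 → lieSU (Fin 2)) → V) (datum : (Fin (F.P K).d → Site (F.P K) (k + 1) → θ.Vβ) → V)
    (hSX : letI := θ.instVβ₁; letI := θ.instVβ₂;
      (fun B => S.chartCfg (unitField F θ k K B)) =ᶠ[𝓝 (0 : Fin (F.P K).d → Site (F.P K) (k + 1) → θ.Vβ)]
        fun B => expChart (1 : GaugeField (F.P K) 0 (SU 2)) (X B))
    (hX₀ : letI := θ.instVβ₁; letI := θ.instVβ₂; X 0 = 0) (hXc : letI := θ.instVβ₁; letI := θ.instVβ₂; ContDiffAt ℝ 2 X 0)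
    (hΨ : ContDiffAt ℝ 2 Ψ 0) (hon : Function.Surjective (fderiv ℝ Ψ 0))
    (hinj : ∀ᶠ q in 𝓝 ((0 : PBond (F.P K) 0 → lieSU (Fin 2)), (0 : PBond (F.P K) 0 → lieSU (Fin 2))), Ψ q.1 = Ψ q.2 →
      avgFamily (avOfRecord F 2 K) (expChart (1 : GaugeField (F.P K) 0 (SU 2)) q.1) (k + 1) =
        avgFamily (avOfRecord F 2 K) (expChart (1 : GaugeField (F.P K) 0 (SU 2)) q.2) (k + 1))
    (hdat : letI := θ.instVβ₁; letI := θ.instVβ₂;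
      ∀ᶠ B in 𝓝 (0 : Fin (F.P K).d → Site (F.P K) (k + 1) → θ.Vβ), Ψ (X B) = datum B)
    (Jcrit : FlatCritDictionary F k K Ψ) (Jcons : FlatConsDictionary F θ k K Ψ datum) :
    (∀ (a : θ.ιβ) (l : RespLabel F k K),
      RootedResponseCriticalModGaugeAt F θ k K a l ∧ RootedResponseOrbitAt F θ k K a l ∧
        RootedResponseInvCriticalAt F θ k K a l ∧ RootedResponseConstraintModGaugeAt F θ k K a l) ∧
    letI := θ.instVβ₁; letI := θ.instVβ₂
    ContDiffAt ℝ 2 (fun B : Fin (F.P K).d → Site (F.P K) (k + 1) → θ.Vβ =>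
      fun (b : PBond (F.P K) 0) (i i' : Fin 2) => ((recordBgField F θ k K B b : SU 2) : Matrix (Fin 2) (Fin 2) ℂ) i i') 0 := by
  letI := θ.instVβ₁; letI := θ.instVβ₂
  have hmem0 := eventually_avgFamily_expChart_eq_unitField F θ k K S Kc range star_mem hdom X hSX
  have hmem : ∀ᶠ B in 𝓝 (0 : Fin (F.P K).d → Site (F.P K) (k + 1) → θ.Vβ),
      avgFamily (avOfRecord F 2 K) (expChart (1 : GaugeField (F.P K) 0 (SU 2)) (X B)) (k + 1) = W B (k + 1) :=
    hmem0.mono fun B hB => by rw [hB, hW]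
  have hsub := psiLetter_near_of_pointwise F k K W X Ψ hX₀ hXc.continuousAt hΨ hon hinj hmem
  exact rootedReceipts_of_tokens_atScale_near F θ k K hk S hR Kc range covers sol_of_isMinOn star_mem star_isMinOn hdom W hW X Ψ datum
    hSX hX₀ hXc (differentiableAt_fderiv_of_contDiffAt_of_two hΨ) hsub hdat Jcrit Jcons

end PsiSuppliersRecord

/-! ### §4h  THE CANONICAL LOGARITHMIC CHART AT THE FLAT REFERENCE inhabits everything on the `Ψ`-side except ONTO-NESS AT `0` ([15] (45) at the flat configuration): two-point injectivity
modulo the averages (n07-e's logarithmic end, two-point edition), `C²` at `0`, the flat guard — so the (R-a) road's `Ψ`-display is ONE letter -/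

section LogChartTwoPoint

open T4AdjointCovarianceUnitary (lieSU expSU coe_expSU)
open B15DeterminingSets (DetSet MSField AgreeOn avgFamily atScale agreeOn_atScale_iff bondsOf)
open MatrixLog (mlog exp_mlog)

variable {N : ℕ} [NeZero N]

/-- **TWO-POINT LEVEL-SET STEP** (n07-e's `eq_one_of_suProj_mlog_eq_zero`, two-point edition): for `g, g′ ∈ SU(N)` both `ρ_N`-close to `1`, `π(log g) = π(log g′) ⇒ g = g′` (`log` lands in
`𝔰𝔲(N)` where `π` is the identity, and `e^{log g} = g`). [cite: Balaban1985Averaging, (21) p.21] -/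
theorem eq_of_suProj_mlog_eq {g g' : Matrix (Fin N) (Fin N) ℂ} (hg : g ∈ Matrix.specialUnitaryGroup (Fin N) ℂ) (hg' : g' ∈ Matrix.specialUnitaryGroup (Fin N) ℂ)
    (hρ : ‖g - 1‖ ≤ rhoSU N) (hρ' : ‖g' - 1‖ ≤ rhoSU N) (h : suProj N (mlog g) = suProj N (mlog g')) : g = g' := by
  have hlog : mlog g = mlog g' := by
    rw [← coe_suProj_mlog_of_mem_SU hg hρ, ← coe_suProj_mlog_of_mem_SU hg' hρ', h]
  have h1 : ‖g - 1‖ < 1 := lt_of_le_of_lt hρ (lt_of_le_of_lt rhoSU_le_third (by norm_num))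
  have h1' : ‖g' - 1‖ < 1 := lt_of_le_of_lt hρ' (lt_of_le_of_lt rhoSU_le_third (by norm_num))
  rw [← exp_mlog h1, hlog, exp_mlog h1']

/-- Equal relative averages against the same datum ⇒ equal averages (`W_j(c) ∈ SU(N)` cancels). [cite: Balaban1988Convergent, (2.10) p.256 (bookkeeping)] -/
theorem avgFamily_eq_of_relAvg_eq {K : ℕ} {W : MSField (F.P K) (SU N)} {V V' : GaugeField (F.P K) 0 (SU N)} {j : ℕ} {c : PBond (F.P K) j}
    (h : relAvg K W V j c = relAvg K W V' j c) : avgFamily (avOfRecord F N K) V j c = avgFamily (avOfRecord F N K) V' j c := by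
  apply Subtype.ext
  have h' := congrArg (fun M => ((W j c : SU N) : Matrix (Fin N) (Fin N) ℂ) * M) h
  simp only [relAvg, ← mul_assoc, coe_mul_star_coe_SU, one_mul] at h'
  exact h'

/-- ★ **TWO-POINT INJECTIVITY OF THE CANONICAL CHART MODULO THE CONSTRAINED AVERAGES, NEAR `(0, 0)`**: for `U` in the fibre with guarded averages and `Y, Y′` near `0`,
`Φ(Y) = Φ(Y′)` forces `Ū^j(U·e^{Y})(c) = Ū^j(U·e^{Y′})(c)` on every constrained bond of level `j ≤ k` — n07-e's level-set clause (`eventually_agreeOn_of_msChart_eq`, `Y′ = 0`) for two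
moving points. [cite: Balaban1985Variational, (82)–(83) p.290; Balaban1988Convergent, (2.10)–(2.12) p.256] -/
theorem eventually_avgFamily_eq_of_msChart_eq_pair {K k : ℕ} {𝔹 : DetSet (F.P K)} {W : MSField (F.P K) (SU N)} {U : GaugeField (F.P K) 0 (SU N)}
    (hU : AgreeOn 𝔹 (avgFamily (avOfRecord F N K) U) W) (hsb : SmallBelow (avOfRecord F N K) k U) {j : ℕ} (hj : j ≤ k) :
    ∀ᶠ q in 𝓝 ((0 : PBond (F.P K) 0 → lieSU (Fin N)), (0 : PBond (F.P K) 0 → lieSU (Fin N))),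
      msChart F N K k 𝔹 W U q.1 = msChart F N K k 𝔹 W U q.2 →
        ∀ c ∈ bondsOf (𝔹 j), avgFamily (avOfRecord F N K) (expChart U q.1) j c = avgFamily (avOfRecord F N K) (expChart U q.2) j c := by
  have h := eventually_norm_relAvg_sub_one_le (k := k) (𝔹 := 𝔹) hU hsb
  have h2 := h.prod_nhds h
  refine h2.mono fun q hq hΦ c hc => ?_
  set s : ConstrSet 𝔹 k := ⟨⟨j, Nat.lt_succ_of_le hj⟩, c, hc⟩ with hs
  have hi := congrFun hΦ (constrEnum 𝔹 k s)
  rw [msChart_apply, msChart_apply, Equiv.symm_apply_apply] at hi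
  have hρ := hq.1 (constrEnum 𝔹 k s)
  have hρ' := hq.2 (constrEnum 𝔹 k s)
  rw [Equiv.symm_apply_apply] at hρ hρ'
  exact avgFamily_eq_of_relAvg_eq F (eq_of_suProj_mlog_eq (relAvg_mem_SU _ _ _) (relAvg_mem_SU _ _ _) hρ hρ' hi)

/-- ★ **ONE-SCALE EDITION**: on `𝐁 = atScale (k+1)` (every bond of level `k+1` constrained), `Φ(Y) = Φ(Y′) ⇒ Ū^{k+1}(U·e^{Y}) = Ū^{k+1}(U·e^{Y′})` for `Y, Y′` near `0` — the `hinj` clause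
of ★★★`rootedReceipts_of_tokens_atScale_pointwise`. [cite: Balaban1985Variational, (82)–(83) p.290; Balaban1988Convergent, (2.10)–(2.12) p.256] -/
theorem eventually_avgFamily_atScale_eq_of_msChart_eq_pair {K k : ℕ} {W : MSField (F.P K) (SU N)} {U : GaugeField (F.P K) 0 (SU N)}
    (hU : AgreeOn (atScale (k + 1)) (avgFamily (avOfRecord F N K) U) W) (hsb : SmallBelow (avOfRecord F N K) (k + 1) U) :
    ∀ᶠ q in 𝓝 ((0 : PBond (F.P K) 0 → lieSU (Fin N)), (0 : PBond (F.P K) 0 → lieSU (Fin N))),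
      msChart F N K (k + 1) (atScale (k + 1)) W U q.1 = msChart F N K (k + 1) (atScale (k + 1)) W U q.2 →
        avgFamily (avOfRecord F N K) (expChart U q.1) (k + 1) = avgFamily (avOfRecord F N K) (expChart U q.2) (k + 1) := by
  refine (eventually_avgFamily_eq_of_msChart_eq_pair F hU hsb le_rfl).mono fun q hq hΦ => ?_
  funext c
  exact hq hΦ c (by simp [atScale, bondsOf])

/-- The flat configuration lies in the fibre of its own averages (trivially). [cite: Balaban1988Convergent, (2.10) p.256 (bookkeeping)] -/
theorem agreeOn_avgFamily_self {K : ℕ} (𝔹 : DetSet (F.P K)) (U : GaugeField (F.P K) 0 (SU N)) : AgreeOn 𝔹 (avgFamily (avOfRecord F N K) U) (avgFamily (avOfRecord F N K) U) :=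
  fun _ _ _ => rfl

/-- ★ **THE FLAT LOGARITHMIC CHART `Ψ₀ := Φ_{atScale (k+1), Ū(1), 1}` IS `C²` AT `0`** (n07-w2's `contDiffAt_msChart` at the flat reference). [cite: Balaban1985Variational, Sect. C p.285, (81)–(83) p.290] -/
theorem contDiffAt_msChart_flat (K k : ℕ) :
    ContDiffAt ℝ 2 (msChart F N K (k + 1) (atScale (k + 1)) (avgFamily (avOfRecord F N K) 1) (1 : GaugeField (F.P K) 0 (SU N))) 0 :=
  (contDiffAt_msChart (agreeOn_avgFamily_self F _ _) (smallBelow_avOfRecord_one F N (k + 1))).of_le le_top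

/-- ★ **THE FLAT LOGARITHMIC CHART IS TWO-POINT INJECTIVE MODULO THE LEVEL-`(k+1)` AVERAGES NEAR `(0,0)`** — the `hinj` clause, INHABITED. [cite: Balaban1985Variational, (82)–(83) p.290;
Balaban1988Convergent, (2.10)–(2.12) p.256] -/
theorem eventually_avgFamily_eq_of_msChart_flat_eq_pair (K k : ℕ) :
    ∀ᶠ q in 𝓝 ((0 : PBond (F.P K) 0 → lieSU (Fin N)), (0 : PBond (F.P K) 0 → lieSU (Fin N))),
      msChart F N K (k + 1) (atScale (k + 1)) (avgFamily (avOfRecord F N K) 1) (1 : GaugeField (F.P K) 0 (SU N)) q.1 =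
          msChart F N K (k + 1) (atScale (k + 1)) (avgFamily (avOfRecord F N K) 1) (1 : GaugeField (F.P K) 0 (SU N)) q.2 →
        avgFamily (avOfRecord F N K) (expChart (1 : GaugeField (F.P K) 0 (SU N)) q.1) (k + 1) =
          avgFamily (avOfRecord F N K) (expChart (1 : GaugeField (F.P K) 0 (SU N)) q.2) (k + 1) :=
  eventually_avgFamily_atScale_eq_of_msChart_eq_pair F (agreeOn_avgFamily_self F _ _) (smallBelow_avOfRecord_one F N (k + 1))

end LogChartTwoPoint

section LogChartRecord

open T4AdjointCovarianceUnitary (lieSU expSU coe_expSU)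
open B15DeterminingSets (DetSet MSField AgreeOn avgFamily atScale agreeOn_atScale_iff)

/-- ★★★ **THE (R-a) ROAD WITH THE CANONICAL FLAT LOGARITHMIC CHART: ONE `Ψ`-LETTER LEFT — ONTO-NESS OF `DΨ₀(0)` ([15] (45) AT THE FLAT CONFIGURATION).**  `Ψ₀ := msChart F 2 K (k+1)
(atScale (k+1)) Ū(1) 1`, datum `:= Ψ₀ ∘ X` (datum clause `rfl`).  Binders = KNIT tokens + `RegimeTok` + domain letter; (s-exp); `X 0 = 0`, `X` of class `C²` at `0`;
`Function.Surjective (fderiv ℝ Ψ₀ 0)` (dag-n10-w1's ✓`surjective_fderiv_msChart_of_flat` currency); (J-crit′) and (J-cons′) for `Ψ₀`.  Everything else on the `Ψ`-side — `C²`, strictness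
and onto-ness along the family, local level sets, members in fibres, minimality ⇒ criticality — is DERIVED.  CONDITIONAL; nothing of [15] asserted. [cite: Balaban1985Variational, Thm 1 p.279,
(45) p.285, Prop. 6 p.295, (82)–(83) p.290, Prop. 8 p.304, Prop. 9 p.309, (177)–(182) p.306–307; Balaban1985RegularSpaces, (1.113)–(1.114) pp.95–97; Balaban1988Convergent, (2.10)–(2.12) p.256] -/
theorem rootedReceipts_of_tokens_atScale_flatLogChart {𝒴 𝒵 : Type} [NormedAddCommGroup 𝒴] [NormedSpace ℂ 𝒴] [CompleteSpace 𝒴] [NormedAddCommGroup 𝒵] [NormedSpace ℂ 𝒵]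
    (k K : ℕ) (hk : k + 1 ≤ (F.P K).m + (F.P K).K) (S : BgScheme F 2 𝒴 𝒵 K (k + 1))
    (hR : S.RegimeTok) (Kc : GaugeField (F.P K) (k + 1) (SU 2) → Set 𝒴)
    (range : ∀ V ∈ S.dom, ∀ A ∈ Kc V, S.chart V A ∈ bgReg F 2 K (k + 1) θ.εbg ∧ Averaging.iter (avOfRecord F 2 K) (k + 1) (S.chart V A) = V)
    (covers : ∀ V ∈ S.dom, ∀ U : GaugeField (F.P K) 0 (SU 2), U ∈ bgReg F 2 K (k + 1) θ.εbg →
      Averaging.iter (avOfRecord F 2 K) (k + 1) U = V → ∃ A ∈ Kc V, OrbitRel (k + 1) (S.chart V A) U)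
    (sol_of_isMinOn : ∀ V ∈ S.dom, ∀ A ∈ Kc V, IsMinOn (wilsonAction4 ∘ S.chart V) (Kc V) A →
      ‖A‖ ≤ S.ε₄ ∧ mapT (S.𝒢 V) 0 (S.W V) (S.J V) (S.𝔄 V) A = A)
    (star_mem : ∀ V ∈ S.dom, S.sol V ∈ Kc V) (star_isMinOn : ∀ V ∈ S.dom, IsMinOn (wilsonAction4 ∘ S.chart V) (Kc V) (S.sol V))
    (hdom : letI := θ.instVβ₁; letI := θ.instVβ₂;
      ∀ᶠ B in 𝓝 (0 : Fin (F.P K).d → Site (F.P K) (k + 1) → θ.Vβ), unitField F θ k K B ∈ S.dom)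
    (W : (Fin (F.P K).d → Site (F.P K) (k + 1) → θ.Vβ) → MSField (F.P K) (SU 2)) (hW : ∀ B, W B (k + 1) = unitField F θ k K B)
    (X : (Fin (F.P K).d → Site (F.P K) (k + 1) → θ.Vβ) → PBond (F.P K) 0 → lieSU (Fin 2))
    (hSX : letI := θ.instVβ₁; letI := θ.instVβ₂;
      (fun B => S.chartCfg (unitField F θ k K B)) =ᶠ[𝓝 (0 : Fin (F.P K).d → Site (F.P K) (k + 1) → θ.Vβ)]
        fun B => expChart (1 : GaugeField (F.P K) 0 (SU 2)) (X B))
    (hX₀ : letI := θ.instVβ₁; letI := θ.instVβ₂; X 0 = 0) (hXc : letI := θ.instVβ₁; letI := θ.instVβ₂; ContDiffAt ℝ 2 X 0)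
    (hon : Function.Surjective
      (fderiv ℝ (msChart F 2 K (k + 1) (atScale (k + 1)) (avgFamily (avOfRecord F 2 K) 1) (1 : GaugeField (F.P K) 0 (SU 2))) 0))
    (Jcrit : FlatCritDictionary F k K (msChart F 2 K (k + 1) (atScale (k + 1)) (avgFamily (avOfRecord F 2 K) 1) (1 : GaugeField (F.P K) 0 (SU 2))))
    (Jcons : FlatConsDictionary F θ k K (msChart F 2 K (k + 1) (atScale (k + 1)) (avgFamily (avOfRecord F 2 K) 1) (1 : GaugeField (F.P K) 0 (SU 2)))
      (fun B => msChart F 2 K (k + 1) (atScale (k + 1)) (avgFamily (avOfRecord F 2 K) 1) (1 : GaugeField (F.P K) 0 (SU 2)) (X B))) :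
    (∀ (a : θ.ιβ) (l : RespLabel F k K),
      RootedResponseCriticalModGaugeAt F θ k K a l ∧ RootedResponseOrbitAt F θ k K a l ∧
        RootedResponseInvCriticalAt F θ k K a l ∧ RootedResponseConstraintModGaugeAt F θ k K a l) ∧
    letI := θ.instVβ₁; letI := θ.instVβ₂
    ContDiffAt ℝ 2 (fun B : Fin (F.P K).d → Site (F.P K) (k + 1) → θ.Vβ =>
      fun (b : PBond (F.P K) 0) (i i' : Fin 2) => ((recordBgField F θ k K B b : SU 2) : Matrix (Fin 2) (Fin 2) ℂ) i i') 0 := by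
  letI := θ.instVβ₁; letI := θ.instVβ₂
  exact rootedReceipts_of_tokens_atScale_pointwise F θ k K hk S hR Kc range covers sol_of_isMinOn star_mem star_isMinOn hdom W hW X
    (msChart F 2 K (k + 1) (atScale (k + 1)) (avgFamily (avOfRecord F 2 K) 1) (1 : GaugeField (F.P K) 0 (SU 2))) _ hSX hX₀ hXc
    (contDiffAt_msChart_flat F K k) hon (eventually_avgFamily_eq_of_msChart_flat_eq_pair F K k) (Eventually.of_forall fun _ => rfl) Jcrit Jcons

end LogChartRecord

end Summit.QuantumFields.YangMills.Theorems.K0AxCtabUniq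

end
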